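import Summits.CriticalPhenomena.SAWScalingLimit.Theorems.HexConjecture.Negative.Reversal
import Literature.Probability.RandomPlanarGeometry.LoewnerDescription
import Literature.Probability.RandomPlanarGeometry.ChordalReversibility
import HarnessLib

/-!
# Exact lattice reversibility turns TWO-SIDED driving convergence into TWO FORWARD statements (stmt-CriticalPhenomena-5423)

Crux `Summit.CriticalPhenomena.SAWScalingLimit.Theses.SAWDevelopingMap.HexTight` (shared verbatim with
`…Theses.SAWResidueField.HexTight`), line `reversible-driving` (skeleton r3, `Cruxes/HexTight/Lines/reversible_driving.lean`),
in support of the research stub `stub_twoSidedDriving`.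

The backward half (iv) of the two-sided driving statement for the critical hexagonal SAW family `(D; a_δ → b_δ)` with a
straightening `c` is LITERALLY a forward-type statement for the REVERSED walk family `(D; b_δ → a_δ)` with the
straightening `γ' ↦ reverse (c δ (sawReverse γ'))`, because the critical weight `x_c^{ℓ(γ)}` is reversal invariant:
`hexSAWLaw Ω δ b a = (hexSAWLaw Ω δ a b).map sawReverse` (`Reversal.hexSAWLaw_swap`, p74061) and `sawReverse` is an
involution. Hence the two-sided statement (both directions for one family) is EQUIVALENT to the pair of forward
statements for the family and its reversal (`twoSided_iff_forwardPair`); the reversed family is again an admissible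
critical SAW family of the swapped Dobrushin domain (`Reversal.isEmbEndpointApprox_swap`). This is the lattice input
that makes Sheffield–Sun's two-direction criterion cost ONE kind of statement for the SAW (S. Sheffield, N. Sun,
Ann. Probab. 40 (2012), §1.4: "we expect [the criterion] to apply in cases where the symmetry of the γ^j and γ^{j−} is
intrinsic to the model"). Statements are written inline (no definitions): the left side of the `iff` is the registered
stub `stub_twoSidedDriving` verbatim.

References: Sheffield–Sun, Ann. Probab. 40 (2012) 578–610, §1.4 [SheffieldSun2012]; Lawler–Schramm–Werner, Proc. Sympos.
Pure Math. 72 (2004), §3.1 (reversal symmetry of the SAW weight) [LawlerSchrammWerner2004SAW]; tagged [folklore].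
(buildfix 2026-08-20: comment-only re-land to re-enqueue the module build after its blocking imports were repaired; no declaration changed.)
-/

noncomputable section

open scoped ENNReal NNReal Topology
open MeasureTheory Filter Topology Set Metric
open UpperHalfPlane (upperHalfPlaneSet)
open Literature Literature.Probability Literature.Probability.LatticeModels
  Literature.Probability.RandomPlanarGeometry Literature.Probability.RandomPlanarGeometry.SAW
open Summit.CriticalPhenomena.SAWScalingLimit.Cruxes.HexConjecture.Reversal

namespace Summit.CriticalPhenomena.SAWScalingLimit.Theorems.HexTight.ReversibleDriving

/-- Change of variables under the exact lattice reversal: integrating an observable of the walk against the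
`(v → u)` law is integrating it, precomposed with `sawReverse`, against the `(u → v)` law. [folklore] -/
theorem integral_hexSAWLaw_swap_comp {Ω : Set ℂ} {δ : ℝ} {u v : HexVertex} {F : Type*}
    [NormedAddCommGroup F] [NormedSpace ℝ F] (g : HexDomainSAW Ω δ v u → F) :
    ∫ γ, g γ ∂(hexSAWLaw Ω δ v u) = ∫ γ, g (sawReverse γ) ∂(hexSAWLaw Ω δ u v) :=
  integral_embLaw_swap hexCriticalFugacity g

/-- **Backward driving convergence ⟺ forward-type driving convergence of the reversed family.** For any
straightening `c` of the `(a_δ → b_δ)` classes and any uniformizer `φ'` of `(D; b, a)`: the backward driving paths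
`W_{φ'}(reverse (c δ γ))` under `hexSAWLaw (a_δ → b_δ)` converge in law to `Z` iff the forward driving paths of
the straightening `γ' ↦ reverse (c δ (sawReverse γ'))` of the REVERSED walks converge in law to `Z` under
`hexSAWLaw (b_δ → a_δ)`. [folklore] -/
theorem backward_iff_forward_reversed {D : DobrushinDomain} {a b : ℝ → HexVertex}
    (φ' : ConformalEquiv upperHalfPlaneSet D.swap.carrier)
    (c : (δ : ℝ) → HexDomainSAW D.carrier δ (a δ) (b δ) → CurveClass ℂ)
    {Ω' : Type*} [MeasurableSpace Ω'] (Z : Ω' → C(ℝ≥0, ℝ)) (P' : Measure Ω') :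
    TendstoLaw
        (fun δ (γ : HexDomainSAW D.carrier δ (a δ) (b δ)) =>
          (⟨drivingFunction φ' (CurveClass.reverse (c δ γ)),
            continuous_drivingFunction φ' (CurveClass.reverse (c δ γ))⟩ : C(ℝ≥0, ℝ)))
        (fun δ => hexSAWLaw D.carrier δ (a δ) (b δ)) Z P' ↔
      TendstoLaw
        (fun δ (γ' : HexDomainSAW D.carrier δ (b δ) (a δ)) =>
          (⟨drivingFunction φ' (CurveClass.reverse (c δ (sawReverse γ'))),
            continuous_drivingFunction φ' (CurveClass.reverse (c δ (sawReverse γ')))⟩ : C(ℝ≥0, ℝ)))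
        (fun δ => hexSAWLaw D.carrier δ (b δ) (a δ)) Z P' := by
  unfold TendstoLaw
  refine forall_congr' fun f => ?_
  have key : ∀ δ : ℝ,
      ∫ γ', f ((⟨drivingFunction φ' (CurveClass.reverse (c δ (sawReverse γ'))),
          continuous_drivingFunction φ' (CurveClass.reverse (c δ (sawReverse γ')))⟩ : C(ℝ≥0, ℝ)))
        ∂(hexSAWLaw D.carrier δ (b δ) (a δ)) =
      ∫ γ, f ((⟨drivingFunction φ' (CurveClass.reverse (c δ γ)),
          continuous_drivingFunction φ' (CurveClass.reverse (c δ γ))⟩ : C(ℝ≥0, ℝ)))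
        ∂(hexSAWLaw D.carrier δ (a δ) (b δ)) := by
    intro δ
    rw [integral_hexSAWLaw_swap_comp]
    simp only [sawReverse_sawReverse]
  simp_rw [key]

/-- **Exact reversibility at work: TWO-SIDED ⟺ FORWARD PAIR.** The two-sided driving statement for the critical
hexagonal SAW (left: forward driving of a straightening `c` AND backward driving of its reversal, both under the
`(a_δ → b_δ)` law — verbatim the registered stub `stub_twoSidedDriving`) is equivalent to the pair of FORWARD
statements (right: the same forward clause, and the forward driving of the straightening
`γ' ↦ reverse (c δ (sawReverse γ'))` of the REVERSED walks under the `(b_δ → a_δ)` law). [folklore] -/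
theorem twoSided_iff_forwardPair :
    (  ∀ (D : DobrushinDomain) (a b : ℝ → HexVertex), IsEmbEndpointApprox hexGraph hexCenter D a b →
    ∀ (φ : ConformalEquiv upperHalfPlaneSet D.carrier) (φ' : ConformalEquiv upperHalfPlaneSet D.swap.carrier),
      D.IsChordalUniformizing φ → D.swap.IsChordalUniformizing φ' →
      ∃ c : (δ : ℝ) → HexDomainSAW D.carrier δ (a δ) (b δ) → CurveClass ℂ,
        (∀ ε : ℝ, 0 < ε →
          Tendsto (fun δ : ℝ => hexSAWLaw D.carrier δ (a δ) (b δ) {γ | ε < dist (c δ γ) γ.curve})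
            (𝓝[>] (0 : ℝ)) (𝓝 0)) ∧
        (∀ᶠ δ : ℝ in 𝓝[>] (0 : ℝ), ∀ γ : HexDomainSAW D.carrier δ (a δ) (b δ),
          c δ γ ∈ CurveClass.simple ∧
            c δ γ ∈ CurveClass.rangeSubset (D.carrier ∪ {D.pt 0, D.pt 1}) ∧
            IsLoewnerDescribable φ (c δ γ) ∧
            IsLoewnerDescribable φ' (CurveClass.reverse (c δ γ))) ∧
        TendstoLaw
          (fun δ (γ : HexDomainSAW D.carrier δ (a δ) (b δ)) =>
            (⟨drivingFunction φ (c δ γ), continuous_drivingFunction φ (c δ γ)⟩ : C(ℝ≥0, ℝ)))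
          (fun δ => hexSAWLaw D.carrier δ (a δ) (b δ))
          (fun ω : ℝ≥0 → ℝ =>
            (⟨sleDriving ((8 : ℝ≥0) / 3) ω, continuous_sleDriving ((8 : ℝ≥0) / 3) ω⟩ : C(ℝ≥0, ℝ)))
          Process.preWienerMeasure ∧
        TendstoLaw
          (fun δ (γ : HexDomainSAW D.carrier δ (a δ) (b δ)) =>
            (⟨drivingFunction φ' (CurveClass.reverse (c δ γ)),
              continuous_drivingFunction φ' (CurveClass.reverse (c δ γ))⟩ : C(ℝ≥0, ℝ)))
          (fun δ => hexSAWLaw D.carrier δ (a δ) (b δ))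
          (fun ω : ℝ≥0 → ℝ =>
            (⟨sleDriving ((8 : ℝ≥0) / 3) ω, continuous_sleDriving ((8 : ℝ≥0) / 3) ω⟩ : C(ℝ≥0, ℝ)))
          Process.preWienerMeasure) ↔
    (  ∀ (D : DobrushinDomain) (a b : ℝ → HexVertex), IsEmbEndpointApprox hexGraph hexCenter D a b →
    ∀ (φ : ConformalEquiv upperHalfPlaneSet D.carrier) (φ' : ConformalEquiv upperHalfPlaneSet D.swap.carrier),
      D.IsChordalUniformizing φ → D.swap.IsChordalUniformizing φ' →
      ∃ c : (δ : ℝ) → HexDomainSAW D.carrier δ (a δ) (b δ) → CurveClass ℂ,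
        (∀ ε : ℝ, 0 < ε →
          Tendsto (fun δ : ℝ => hexSAWLaw D.carrier δ (a δ) (b δ) {γ | ε < dist (c δ γ) γ.curve})
            (𝓝[>] (0 : ℝ)) (𝓝 0)) ∧
        (∀ᶠ δ : ℝ in 𝓝[>] (0 : ℝ), ∀ γ : HexDomainSAW D.carrier δ (a δ) (b δ),
          c δ γ ∈ CurveClass.simple ∧
            c δ γ ∈ CurveClass.rangeSubset (D.carrier ∪ {D.pt 0, D.pt 1}) ∧
            IsLoewnerDescribable φ (c δ γ) ∧
            IsLoewnerDescribable φ' (CurveClass.reverse (c δ γ))) ∧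
        TendstoLaw
          (fun δ (γ : HexDomainSAW D.carrier δ (a δ) (b δ)) =>
            (⟨drivingFunction φ (c δ γ), continuous_drivingFunction φ (c δ γ)⟩ : C(ℝ≥0, ℝ)))
          (fun δ => hexSAWLaw D.carrier δ (a δ) (b δ))
          (fun ω : ℝ≥0 → ℝ =>
            (⟨sleDriving ((8 : ℝ≥0) / 3) ω, continuous_sleDriving ((8 : ℝ≥0) / 3) ω⟩ : C(ℝ≥0, ℝ)))
          Process.preWienerMeasure ∧
        TendstoLaw
          (fun δ (γ' : HexDomainSAW D.carrier δ (b δ) (a δ)) =>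
            (⟨drivingFunction φ' (CurveClass.reverse (c δ (sawReverse γ'))),
              continuous_drivingFunction φ' (CurveClass.reverse (c δ (sawReverse γ')))⟩ : C(ℝ≥0, ℝ)))
          (fun δ => hexSAWLaw D.carrier δ (b δ) (a δ))
          (fun ω : ℝ≥0 → ℝ =>
            (⟨sleDriving ((8 : ℝ≥0) / 3) ω, continuous_sleDriving ((8 : ℝ≥0) / 3) ω⟩ : C(ℝ≥0, ℝ)))
          Process.preWienerMeasure) := by
  refine forall_congr' fun D => forall_congr' fun a => forall_congr' fun b => forall_congr' fun _ => ?_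
  refine forall_congr' fun φ => forall_congr' fun φ' => forall_congr' fun _ => forall_congr' fun _ => ?_
  refine exists_congr fun c => ?_
  refine and_congr_right fun _ => and_congr_right fun _ => and_congr_right fun _ => ?_
  exact backward_iff_forward_reversed φ' c _ _

/-- The reversed walk family is again a critical hexagonal SAW family with a legitimate endpoint approximation of
the swapped Dobrushin domain, so the second forward statement of `twoSided_iff_forwardPair` is an INSTANCE of the
first (for `D.swap`, endpoints `(b, a)`). [folklore] -/
theorem reversed_family_is_admissible {D : DobrushinDomain} {a b : ℝ → HexVertex}
    (hab : IsEmbEndpointApprox hexGraph hexCenter D a b) :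
    IsEmbEndpointApprox hexGraph hexCenter D.swap b a :=
  isEmbEndpointApprox_swap hab

end Summit.CriticalPhenomena.SAWScalingLimit.Theorems.HexTight.ReversibleDriving

end
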